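import Literature.NumberTheory.LFunctions.ExplicitFormulaPsiOneTrivialZeros
import Literature.NumberTheory.LFunctions.WeilZeroSum
import Literature.NumberTheory.LFunctions.ZetaPartialSumAtZeros
import Literature.NumberTheory.LFunctions.ZetaZerosReflection
import Summits.RiemannHypothesis.RiemannHypothesis.Theorems.LiCoefficientsDefs
import HarnessLib

/-!
# RiemannHypothesis / Nyman–Beurling — the DILATE ZERO SUMS, I: reflection and the integrated identity
# `Φ(x) = x(β + P(1)) − P(x)/x − 2x ∫_1^x P(t) t⁻³ dt` (RH-FREE)

Column LI/NB of the RH ladder, rung L-P(P2) «structure of the NB minimiser», PROOF-OF-DATA for cell `pub/rh-li`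
[rh-li-eng-3 g5].  Theory target (T7) `NbDilateZeroSumExplicit` (`theory/NBHeadTail.lean`; tree defs
`nbDilateZeroSum`, `nbDilatePrimeSide` in `LiCoefficientsDefs.lean`): the dilate zero sums
`S(n) = Σ_ρ m_ρ n^{−ρ}/(ρ(1−ρ))` that drive the κ-law of the NB minimiser are PRIME-SIDE numbers.  The first conjunct
`S(1) = 2 + γ − log 4π` is `nbDilateZeroSum_one` (g4).  This file is step I of the `n ≥ 2` conjunct, derived from the
tree's EXACT explicit formula for `ψ₁` (`Literature.NumberTheory.LFunctions.psiOne_eq_explicit_trivialZeros`) by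
real-variable calculus — no new contour integration:

* `nbDilateZeroSum_eq_tsum_div` (REFLECTION `ρ ↦ 1 − ρ`, `m(1−ρ) = m(ρ)`): `S(n) = Φ(n)/n` with
  `Φ(x) = Σ_ρ m_ρ x^ρ/(ρ(1−ρ))`;
* `phiTerm_eq` (termwise calculus; partial fractions `2/((ρ−1)ρ(ρ+1)) = 1/(ρ(ρ−1)) − 1/(ρ(ρ+1))` and
  `∫_1^x t^{ρ−2} dt = (x^{ρ−1} − 1)/(ρ − 1)`):
  `m_ρ x^ρ/(ρ(1−ρ)) = x(m_ρ/(ρ(1−ρ)) + m_ρ/(ρ(ρ+1))) − m_ρ x^{ρ+1}/(ρ(ρ+1))/x − 2x ∫_1^x m_ρ t^{ρ+1}/(ρ(ρ+1)) t⁻³ dt`;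
* `hasSum_integral_pTermDiv` (dominated convergence, weights `w_ρ = m_ρ/(|ρ||ρ+1|)`, summable by the tree's
  `summable_norm_psiOne_zeroTerm`): `Σ_ρ ∫_1^x (…) = ∫_1^x P(t) t⁻³ dt`, `P(x) = Σ_ρ m_ρ x^{ρ+1}/(ρ(ρ+1))`
  (the zero sum of the `ψ₁` formula);
* `phi_eq` — **`Φ(x) = x(β + P(1)) − P(x)/x − 2x ∫_1^x P(t) t⁻³ dt`** for every real `x ≥ 1`, `β = 2 + γ − log 4π`
  (`nicolasBeta`; `phi_one : Φ(1) = β`).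

Step II (sequel files) inserts the explicit formula for `P` and evaluates the elementary integrals.
RH-FREE [rh-li-eng-3 g5]: unconditional explicit-formula analysis (absolutely convergent zero sums); nothing here bears
on `d_N → 0` or on the truth of RH.
-/

noncomputable section

set_option linter.dupNamespace false

open Complex Filter Set MeasureTheory Topology intervalIntegral
open scoped Real ComplexConjugate

namespace Summit.RiemannHypothesis.RiemannHypothesis.Theorems.NbTheory

open Literature.NumberTheory.LFunctions

namespace DilateExplicit

/-! Notation used in the docstrings only: `Φ(x) = Σ_ρ m_ρ x^ρ/(ρ(1−ρ))`, `P(x) = Σ_ρ m_ρ x^{ρ+1}/(ρ(ρ+1))` (the zero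
sum of the tree's explicit formula for `ψ₁`), `w_ρ = m_ρ/(|ρ||ρ+1|)`; all sums over the non-trivial zeros with
multiplicity.  No definitions are introduced (the expressions are spelled out in every statement). -/

/-- `ρ ≠ 0` for a non-trivial zero. -/
lemma ne_zero_of_mem {ρ : ℂ} (h : ρ ∈ ZetaZeros.riemannZetaNontrivialZeros) : ρ ≠ 0 := by
  intro h0
  have := ZetaZeros.riemannZetaNontrivialZeros.re_pos h
  rw [h0] at this; simp at this

/-- `1 − ρ ≠ 0` for a non-trivial zero. -/
lemma one_sub_ne_zero_of_mem {ρ : ℂ} (h : ρ ∈ ZetaZeros.riemannZetaNontrivialZeros) : 1 - ρ ≠ 0 :=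
  sub_ne_zero.2 (ZetaZeros.riemannZetaNontrivialZeros.ne_one h).symm

/-- `ρ + 1 ≠ 0` for a non-trivial zero. -/
lemma add_one_ne_zero_of_mem {ρ : ℂ} (h : ρ ∈ ZetaZeros.riemannZetaNontrivialZeros) : ρ + 1 ≠ 0 := by
  intro h0
  have := ZetaZeros.riemannZetaNontrivialZeros.re_pos h
  have h1 : ρ = -1 := by linear_combination h0
  rw [h1] at this; simp at this; linarith

/-- `ρ − 1 ≠ 0` for a non-trivial zero. -/
lemma sub_one_ne_zero_of_mem {ρ : ℂ} (h : ρ ∈ ZetaZeros.riemannZetaNontrivialZeros) : ρ - 1 ≠ 0 :=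
  sub_ne_zero.2 (ZetaZeros.riemannZetaNontrivialZeros.ne_one h)

/-- **Reflection.** For `n ≥ 1`: `S(n) = Σ_ρ m_ρ n^{−ρ}/(ρ(1−ρ)) = Φ(n)/n` (re-index by `ρ ↦ 1 − ρ`,
`m(1−ρ) = m(ρ)`). -/
theorem nbDilateZeroSum_eq_tsum_div {n : ℕ} (hn : 1 ≤ n) :
    nbDilateZeroSum n = (∑' ρ : ZetaZeros.riemannZetaNontrivialZeros,
      (riemannZetaZeroOrder (ρ : ℂ) : ℂ) * (n : ℂ) ^ (ρ : ℂ) / ((ρ : ℂ) * (1 - (ρ : ℂ)))) / n := by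
  have hn0 : (n : ℂ) ≠ 0 := by exact_mod_cast (show n ≠ 0 by omega)
  -- the involution `ρ ↦ 1 − ρ`
  let e : ZetaZeros.riemannZetaNontrivialZeros ≃ ZetaZeros.riemannZetaNontrivialZeros :=
    { toFun := fun ρ ↦ ⟨1 - (ρ : ℂ), ZetaZeros.riemannZetaNontrivialZeros.one_sub_mem ρ.2⟩
      invFun := fun ρ ↦ ⟨1 - (ρ : ℂ), ZetaZeros.riemannZetaNontrivialZeros.one_sub_mem ρ.2⟩
      left_inv := fun ρ ↦ by ext; simp
      right_inv := fun ρ ↦ by ext; simp }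
  unfold nbDilateZeroSum
  rw [← Equiv.tsum_eq e]
  rw [div_eq_mul_inv, ← tsum_mul_right]
  refine tsum_congr fun ρ ↦ ?_
  have hρ := ρ.2
  simp only [e, Equiv.coe_fn_mk]
  rw [riemannZetaZeroOrder_one_sub_holds (ZetaZeros.riemannZetaNontrivialZeros.re_pos hρ)
    (ZetaZeros.riemannZetaNontrivialZeros.re_lt_one hρ)]
  have hpow : (n : ℂ) ^ (-(1 - (ρ : ℂ))) = (n : ℂ) ^ (ρ : ℂ) * (n : ℂ)⁻¹ := by
    rw [show (-(1 - (ρ : ℂ))) = (ρ : ℂ) - 1 by ring, Complex.cpow_sub _ _ hn0, Complex.cpow_one,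
      div_eq_mul_inv]
  rw [hpow, sub_sub_cancel]
  have h1 := ne_zero_of_mem hρ
  have h2 := one_sub_ne_zero_of_mem hρ
  field_simp

/-! ## The weights `w_ρ = m_ρ/(|ρ||ρ+1|)` (summable) dominate the `P`-terms on `t ≥ 1` -/

/-- `0 < m_ρ` (as a real number) for a non-trivial zero. -/
lemma zeroOrder_pos (ρ : ZetaZeros.riemannZetaNontrivialZeros) : (0 : ℝ) < riemannZetaZeroOrder (ρ : ℂ) := by
  have h : (1 : ℤ) ≤ riemannZetaZeroOrder (ρ : ℂ) := ZetaZeros.riemannZetaNontrivialZeros.one_le_order ρ.2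
  have h0 : (0 : ℤ) < riemannZetaZeroOrder (ρ : ℂ) := by omega
  exact_mod_cast h0

/-- `‖(m_ρ : ℂ)‖ = m_ρ`. -/
lemma norm_zeroOrder (ρ : ZetaZeros.riemannZetaNontrivialZeros) :
    ‖(riemannZetaZeroOrder (ρ : ℂ) : ℂ)‖ = (riemannZetaZeroOrder (ρ : ℂ) : ℝ) := by
  rw [Complex.norm_intCast, abs_of_pos (zeroOrder_pos ρ)]

/-- The `P`-term at `x = 1` has norm `w_ρ`. -/
lemma norm_pTerm_one (ρ : ZetaZeros.riemannZetaNontrivialZeros) :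
    ‖(riemannZetaZeroOrder (ρ : ℂ) : ℂ) * ((((1 : ℝ) : ℂ)) ^ ((ρ : ℂ) + 1) / ((ρ : ℂ) * (ρ + 1)))‖ =
      ((riemannZetaZeroOrder (ρ : ℂ) : ℝ) / (‖(ρ : ℂ)‖ * ‖(ρ : ℂ) + 1‖)) := by
  rw [Complex.ofReal_one, Complex.one_cpow, norm_mul, norm_div, norm_one, norm_mul, norm_zeroOrder]
  ring

/-- `Σ_ρ w_ρ < ∞` (the absolute convergence of the `ψ₁` zero sum at `x = 1`). -/
lemma summable_w : Summable fun ρ : ZetaZeros.riemannZetaNontrivialZeros ↦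
    ((riemannZetaZeroOrder (ρ : ℂ) : ℝ) / (‖(ρ : ℂ)‖ * ‖(ρ : ℂ) + 1‖)) := by
  have h := summable_norm_psiOne_zeroTerm (le_refl (1 : ℝ))
  refine h.congr fun ρ ↦ ?_
  exact norm_pTerm_one ρ

/-- For `t ≥ 1`: `‖m_ρ t^{ρ+1}/(ρ(ρ+1)) / t³‖ ≤ w_ρ` (`t^{Re ρ + 1} ≤ t³`). -/
lemma norm_pTermDiv_le (ρ : ZetaZeros.riemannZetaNontrivialZeros) {t : ℝ} (ht : 1 ≤ t) :
    ‖(riemannZetaZeroOrder (ρ : ℂ) : ℂ) * ((t : ℂ) ^ ((ρ : ℂ) + 1) / ((ρ : ℂ) * (ρ + 1))) / (t : ℂ) ^ 3‖ ≤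
      ((riemannZetaZeroOrder (ρ : ℂ) : ℝ) / (‖(ρ : ℂ)‖ * ‖(ρ : ℂ) + 1‖)) := by
  have ht0 : 0 < t := by linarith
  have hre : ((ρ : ℂ) + 1).re ≤ 3 := by
    have := ZetaZeros.riemannZetaNontrivialZeros.re_lt_one ρ.2
    simp; linarith
  have hpow : ‖(t : ℂ) ^ ((ρ : ℂ) + 1)‖ ≤ t ^ 3 := by
    rw [Complex.norm_cpow_eq_rpow_re_of_pos ht0]
    calc t ^ ((ρ : ℂ) + 1).re ≤ t ^ (3 : ℝ) := Real.rpow_le_rpow_of_exponent_le ht hre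
      _ = t ^ 3 := by norm_cast
  have ht3 : ‖(t : ℂ) ^ 3‖ = t ^ 3 := by
    rw [norm_pow, Complex.norm_real, Real.norm_eq_abs, abs_of_pos ht0]
  have hden : 0 < ‖(ρ : ℂ)‖ * ‖(ρ : ℂ) + 1‖ :=
    mul_pos (norm_pos_iff.2 (ne_zero_of_mem ρ.2)) (norm_pos_iff.2 (add_one_ne_zero_of_mem ρ.2))
  rw [norm_div, norm_mul, norm_div, norm_mul, norm_zeroOrder, ht3]
  have hm := (zeroOrder_pos ρ).le
  have ht3pos : 0 < t ^ 3 := by positivity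
  calc (riemannZetaZeroOrder (ρ : ℂ) : ℝ) * (‖(t : ℂ) ^ ((ρ : ℂ) + 1)‖ / (‖(ρ : ℂ)‖ * ‖(ρ : ℂ) + 1‖)) / t ^ 3
      = (riemannZetaZeroOrder (ρ : ℂ) : ℝ) / (‖(ρ : ℂ)‖ * ‖(ρ : ℂ) + 1‖) * (‖(t : ℂ) ^ ((ρ : ℂ) + 1)‖ / t ^ 3) := by
        ring
    _ ≤ (riemannZetaZeroOrder (ρ : ℂ) : ℝ) / (‖(ρ : ℂ)‖ * ‖(ρ : ℂ) + 1‖) * 1 :=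
        mul_le_mul_of_nonneg_left (div_le_one_of_le₀ hpow ht3pos.le) (div_nonneg hm hden.le)
    _ = (riemannZetaZeroOrder (ρ : ℂ) : ℝ) / (‖(ρ : ℂ)‖ * ‖(ρ : ℂ) + 1‖) := mul_one _

/-- `t ↦ m_ρ t^{ρ+1}/(ρ(ρ+1))/t³` is continuous on `(0, ∞)`. -/
lemma continuousOn_pTermDiv (ρ : ZetaZeros.riemannZetaNontrivialZeros) :
    ContinuousOn (fun t : ℝ ↦
      (riemannZetaZeroOrder (ρ : ℂ) : ℂ) * ((t : ℂ) ^ ((ρ : ℂ) + 1) / ((ρ : ℂ) * (ρ + 1))) / (t : ℂ) ^ 3) (Set.Ioi 0) := by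
  have hre : 0 < ((ρ : ℂ) + 1).re := by
    have := ZetaZeros.riemannZetaNontrivialZeros.re_pos ρ.2
    simp; linarith
  have h1 : Continuous fun t : ℝ ↦ (t : ℂ) ^ ((ρ : ℂ) + 1) := Complex.continuous_ofReal_cpow_const hre
  refine ContinuousOn.div ((continuousOn_const.mul (h1.continuousOn.div_const _))) (by fun_prop) ?_
  intro t ht
  exact pow_ne_zero 3 (Complex.ofReal_ne_zero.2 (ne_of_gt ht))

/-- The pointwise sum: for `t ≥ 1`, `Σ_ρ m_ρ t^{ρ+1}/(ρ(ρ+1))/t³ = P(t)/t³`. -/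
lemma hasSum_pTermDiv {t : ℝ} (ht : 1 ≤ t) :
    HasSum (fun ρ : ZetaZeros.riemannZetaNontrivialZeros ↦
      (riemannZetaZeroOrder (ρ : ℂ) : ℂ) * ((t : ℂ) ^ ((ρ : ℂ) + 1) / ((ρ : ℂ) * (ρ + 1))) / (t : ℂ) ^ 3)
      ((∑' ρ : ZetaZeros.riemannZetaNontrivialZeros,
      (riemannZetaZeroOrder (ρ : ℂ) : ℂ) * ((t : ℂ) ^ ((ρ : ℂ) + 1) / ((ρ : ℂ) * (ρ + 1)))) / (t : ℂ) ^ 3) := by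
  have h := (summable_norm_psiOne_zeroTerm ht).of_norm.hasSum
  exact h.div_const _

/-- **Term-by-term integration of `P(t)/t³` over `[1, x]`.** -/
theorem hasSum_integral_pTermDiv {x : ℝ} (hx : 1 ≤ x) :
    HasSum (fun ρ : ZetaZeros.riemannZetaNontrivialZeros ↦ ∫ t in (1 : ℝ)..x,
      (riemannZetaZeroOrder (ρ : ℂ) : ℂ) * ((t : ℂ) ^ ((ρ : ℂ) + 1) / ((ρ : ℂ) * (ρ + 1))) / (t : ℂ) ^ 3)
      (∫ t in (1 : ℝ)..x, (∑' ρ : ZetaZeros.riemannZetaNontrivialZeros,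
      (riemannZetaZeroOrder (ρ : ℂ) : ℂ) * ((t : ℂ) ^ ((ρ : ℂ) + 1) / ((ρ : ℂ) * (ρ + 1)))) / (t : ℂ) ^ 3) := by
  have hI : Set.uIoc (1 : ℝ) x = Set.Ioc 1 x := Set.uIoc_of_le hx
  refine intervalIntegral.hasSum_integral_of_dominated_convergence
    (fun ρ _ ↦ ((riemannZetaZeroOrder (ρ : ℂ) : ℝ) / (‖(ρ : ℂ)‖ * ‖(ρ : ℂ) + 1‖))) ?_ ?_ ?_ ?_ ?_
  · intro ρ
    rw [hI]
    exact ((continuousOn_pTermDiv ρ).mono fun t ht ↦ lt_trans zero_lt_one ht.1).aestronglyMeasurable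
      measurableSet_Ioc
  · intro ρ
    refine ae_of_all _ fun t ht ↦ ?_
    rw [hI] at ht
    exact norm_pTermDiv_le ρ ht.1.le
  · exact ae_of_all _ fun t _ ↦ summable_w
  · exact intervalIntegrable_const
  · refine ae_of_all _ fun t ht ↦ ?_
    rw [hI] at ht
    exact hasSum_pTermDiv ht.1.le

/-- The termwise integral in closed form: `∫_1^x m_ρ t^{ρ+1}/(ρ(ρ+1)) t⁻³ dt = m_ρ (x^{ρ−1} − 1)/((ρ−1)ρ(ρ+1))`. -/
lemma integral_pTermDiv (ρ : ZetaZeros.riemannZetaNontrivialZeros) {x : ℝ} (hx : 1 ≤ x) :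
    ∫ t in (1 : ℝ)..x,
        (riemannZetaZeroOrder (ρ : ℂ) : ℂ) * ((t : ℂ) ^ ((ρ : ℂ) + 1) / ((ρ : ℂ) * (ρ + 1))) / (t : ℂ) ^ 3 =
      (riemannZetaZeroOrder (ρ : ℂ) : ℂ) / ((ρ : ℂ) * (ρ + 1)) *
        (((x : ℂ) ^ ((ρ : ℂ) - 1) - 1) / ((ρ : ℂ) - 1)) := by
  have hcongr : ∫ t in (1 : ℝ)..x,
        (riemannZetaZeroOrder (ρ : ℂ) : ℂ) * ((t : ℂ) ^ ((ρ : ℂ) + 1) / ((ρ : ℂ) * (ρ + 1))) / (t : ℂ) ^ 3 =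
      ∫ t in (1 : ℝ)..x, (riemannZetaZeroOrder (ρ : ℂ) : ℂ) / ((ρ : ℂ) * (ρ + 1)) * (t : ℂ) ^ ((ρ : ℂ) - 2) := by
    refine intervalIntegral.integral_congr fun t ht ↦ ?_
    rw [Set.uIcc_of_le hx] at ht
    have ht0 : (t : ℂ) ≠ 0 := Complex.ofReal_ne_zero.2 (by linarith [ht.1])
    have hsplit : (t : ℂ) ^ ((ρ : ℂ) + 1) = (t : ℂ) ^ ((ρ : ℂ) - 2) * (t : ℂ) ^ 3 := by
      rw [← Complex.cpow_natCast, ← Complex.cpow_add _ _ ht0]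
      congr 1; push_cast; ring
    rw [hsplit]
    field_simp
  have hr : (ρ : ℂ) - 2 ≠ -1 ∧ (0 : ℝ) ∉ Set.uIcc (1 : ℝ) x := by
    refine ⟨fun h ↦ ZetaZeros.riemannZetaNontrivialZeros.ne_one ρ.2 (by linear_combination h), ?_⟩
    rw [Set.uIcc_of_le hx]
    intro h; exact absurd h.1 (by norm_num)
  rw [hcongr, intervalIntegral.integral_const_mul, integral_cpow (Or.inr hr)]
  have e1 : (ρ : ℂ) - 2 + 1 = (ρ : ℂ) - 1 := by ring
  rw [e1, Complex.ofReal_one, Complex.one_cpow]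

/-- **The termwise calculus identity** (partial fractions `2/((ρ−1)ρ(ρ+1)) = 1/(ρ(ρ−1)) − 1/(ρ(ρ+1))`): for `x ≥ 1`,
`m_ρ x^ρ/(ρ(1−ρ)) = x·(m_ρ/(ρ(1−ρ)) + m_ρ/(ρ(ρ+1))) − (m_ρ x^{ρ+1}/(ρ(ρ+1)))/x − 2x ∫_1^x m_ρ t^{ρ+1}/(ρ(ρ+1)) t⁻³ dt`. -/
theorem phiTerm_eq (ρ : ZetaZeros.riemannZetaNontrivialZeros) {x : ℝ} (hx : 1 ≤ x) :
    (riemannZetaZeroOrder (ρ : ℂ) : ℂ) * (x : ℂ) ^ (ρ : ℂ) / ((ρ : ℂ) * (1 - (ρ : ℂ))) =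
      (x : ℂ) * ((riemannZetaZeroOrder (ρ : ℂ) : ℂ) / ((ρ : ℂ) * (1 - ρ)) +
          (riemannZetaZeroOrder (ρ : ℂ) : ℂ) * ((((1 : ℝ) : ℂ)) ^ ((ρ : ℂ) + 1) / ((ρ : ℂ) * (ρ + 1)))) -
        (riemannZetaZeroOrder (ρ : ℂ) : ℂ) * ((x : ℂ) ^ ((ρ : ℂ) + 1) / ((ρ : ℂ) * (ρ + 1))) / x -
        2 * (x : ℂ) * ∫ t in (1 : ℝ)..x,
          (riemannZetaZeroOrder (ρ : ℂ) : ℂ) * ((t : ℂ) ^ ((ρ : ℂ) + 1) / ((ρ : ℂ) * (ρ + 1))) / (t : ℂ) ^ 3 := by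
  have hx0 : (x : ℂ) ≠ 0 := Complex.ofReal_ne_zero.2 (by linarith)
  rw [integral_pTermDiv ρ hx, Complex.ofReal_one, Complex.one_cpow]
  have h1 : (x : ℂ) ^ ((ρ : ℂ) + 1) = (x : ℂ) ^ (ρ : ℂ) * x := by
    rw [Complex.cpow_add _ _ hx0, Complex.cpow_one]
  have h2 : (x : ℂ) ^ ((ρ : ℂ) - 1) = (x : ℂ) ^ (ρ : ℂ) / x := by
    rw [Complex.cpow_sub _ _ hx0, Complex.cpow_one]
  rw [h1, h2]
  have hρ0 := ne_zero_of_mem ρ.2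
  have hρ1 := one_sub_ne_zero_of_mem ρ.2
  have hρ2 := add_one_ne_zero_of_mem ρ.2
  have hρ3 := sub_one_ne_zero_of_mem ρ.2
  field_simp
  ring

/-- `Φ(1) = Σ_ρ m_ρ/(ρ(1−ρ)) = 2 + γ − log 4π` (Nicolas's `β`; tree `hasSum_zeroOrder_div_mul_one_sub`). -/
theorem hasSum_phiTerm_one :
    HasSum (fun ρ : ZetaZeros.riemannZetaNontrivialZeros ↦ (riemannZetaZeroOrder (ρ : ℂ) : ℂ) / ((ρ : ℂ) * (1 - ρ)))
      (nicolasBeta : ℂ) :=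
  hasSum_zeroOrder_div_mul_one_sub

/-- `P(x)` is the sum of its terms (`x ≥ 1`). -/
theorem hasSum_pTerm {x : ℝ} (hx : 1 ≤ x) :
    HasSum (fun ρ : ZetaZeros.riemannZetaNontrivialZeros ↦
      (riemannZetaZeroOrder (ρ : ℂ) : ℂ) * ((x : ℂ) ^ ((ρ : ℂ) + 1) / ((ρ : ℂ) * (ρ + 1))))
      (∑' ρ : ZetaZeros.riemannZetaNontrivialZeros,
      (riemannZetaZeroOrder (ρ : ℂ) : ℂ) * ((x : ℂ) ^ ((ρ : ℂ) + 1) / ((ρ : ℂ) * (ρ + 1)))) :=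
  (summable_norm_psiOne_zeroTerm hx).of_norm.hasSum

/-- **THE INTEGRATED IDENTITY (RH-FREE).**  For `x ≥ 1`:
`Φ(x) = x·(β + P(1)) − P(x)/x − 2x ∫_1^x P(t) t⁻³ dt`, `β = 2 + γ − log 4π`, `P` the zero sum of the explicit
formula for `ψ₁`. -/
theorem phi_eq {x : ℝ} (hx : 1 ≤ x) :
    (∑' ρ : ZetaZeros.riemannZetaNontrivialZeros,
      (riemannZetaZeroOrder (ρ : ℂ) : ℂ) * (x : ℂ) ^ (ρ : ℂ) / ((ρ : ℂ) * (1 - (ρ : ℂ)))) =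
      (x : ℂ) * ((nicolasBeta : ℂ) + (∑' ρ : ZetaZeros.riemannZetaNontrivialZeros,
      (riemannZetaZeroOrder (ρ : ℂ) : ℂ) * (((1 : ℝ) : ℂ) ^ ((ρ : ℂ) + 1) / ((ρ : ℂ) * (ρ + 1))))) -
      (∑' ρ : ZetaZeros.riemannZetaNontrivialZeros,
      (riemannZetaZeroOrder (ρ : ℂ) : ℂ) * ((x : ℂ) ^ ((ρ : ℂ) + 1) / ((ρ : ℂ) * (ρ + 1)))) / x -
      2 * (x : ℂ) * ∫ t in (1 : ℝ)..x, (∑' ρ : ZetaZeros.riemannZetaNontrivialZeros,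
      (riemannZetaZeroOrder (ρ : ℂ) : ℂ) * ((t : ℂ) ^ ((ρ : ℂ) + 1) / ((ρ : ℂ) * (ρ + 1)))) / (t : ℂ) ^ 3 := by
  have hsum := (((hasSum_phiTerm_one.add (hasSum_pTerm (le_refl (1 : ℝ)))).mul_left (x : ℂ)).sub
    ((hasSum_pTerm hx).div_const (x : ℂ))).sub ((hasSum_integral_pTermDiv hx).mul_left (2 * (x : ℂ)))
  have key : (fun ρ : ZetaZeros.riemannZetaNontrivialZeros ↦
      (riemannZetaZeroOrder (ρ : ℂ) : ℂ) * (x : ℂ) ^ (ρ : ℂ) / ((ρ : ℂ) * (1 - (ρ : ℂ)))) =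
      fun ρ : ZetaZeros.riemannZetaNontrivialZeros ↦
        (x : ℂ) * ((riemannZetaZeroOrder (ρ : ℂ) : ℂ) / ((ρ : ℂ) * (1 - ρ)) +
          (riemannZetaZeroOrder (ρ : ℂ) : ℂ) * ((((1 : ℝ) : ℂ)) ^ ((ρ : ℂ) + 1) / ((ρ : ℂ) * (ρ + 1)))) -
        (riemannZetaZeroOrder (ρ : ℂ) : ℂ) * ((x : ℂ) ^ ((ρ : ℂ) + 1) / ((ρ : ℂ) * (ρ + 1))) / x -
        2 * (x : ℂ) * ∫ t in (1 : ℝ)..x,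
          (riemannZetaZeroOrder (ρ : ℂ) : ℂ) * ((t : ℂ) ^ ((ρ : ℂ) + 1) / ((ρ : ℂ) * (ρ + 1))) / (t : ℂ) ^ 3 :=
    funext fun ρ ↦ phiTerm_eq ρ hx
  rw [key]
  exact hsum.tsum_eq

/-- `Φ(1) = β = 2 + γ − log 4π`. -/
theorem phi_one : (∑' ρ : ZetaZeros.riemannZetaNontrivialZeros,
      (riemannZetaZeroOrder (ρ : ℂ) : ℂ) * ((1 : ℝ) : ℂ) ^ (ρ : ℂ) / ((ρ : ℂ) * (1 - (ρ : ℂ)))) = (nicolasBeta : ℂ) := by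
  rw [← hasSum_phiTerm_one.tsum_eq]
  refine tsum_congr fun ρ ↦ ?_
  rw [Complex.ofReal_one, Complex.one_cpow, mul_one]

end DilateExplicit

end Summit.RiemannHypothesis.RiemannHypothesis.Theorems.NbTheory

end
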